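import Summits.QuantumAdvantage.QuantumAdvantage.Theorems.LinnikCubicClassGroupsDegreeOnePrimesEscapeShortIntervalWindowExc
import HarnessLib

/-!
# Prime ideals of a class in short intervals, VI: every degree

Topic `Summits/QuantumAdvantage/QuantumAdvantage/Theorems`, cell B2b-1 (linnik-cubic), PART A (gen 5);
helper for the crux `DegreeOnePrimesEscape` (stmt-QuantumAdvantage-11543).  HONEST FRAMING: the value
of this file is a THEOREM (kernel-checked, GRH-free, Siegel-free) — NOT summit progress.

`classPsi_shortInterval_dichotomy`: for every number field `K` of degree `n > 1`, every class `C`,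
`x ≥ Q^{a₀}`, `x^{1−δ} ≤ h ≤ x`: EITHER `h/(8h_K) ≤ ψ_C(x+h) − ψ_C(x) ≤ 4h/h_K` for all classes, OR a real
class group character `χ₁` has a real zero `β₁ ∈ (1 − c/(log|d_K| + log 4), 1)` and then
`ψ_C(x+h) − ψ_C(x) ≤ 8h/h_K` for ALL classes and `h/(8h_K) ≤ ψ_C(x+h) − ψ_C(x)` whenever `χ₁(C) = −1`.
Corollary `classPsi_shortInterval_upper` (Brun–Titchmarsh type): `ψ_C(x+h) − ψ_C(x) ≤ 8h/h_K` for
every class of every number field of degree `n`, unconditionally.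
-/

noncomputable section

open Complex Real MeasureTheory Set Filter Topology
open scoped NumberField nonZeroDivisors

namespace Summit.QuantumAdvantage.QuantumAdvantage.Theorems.DegreeOnePrimesEscape

open Literature.NumberTheory.LFunctions Literature.NumberTheory.LFunctions.NumberField
  Literature.NumberTheory.LFunctions.EntireEF Literature.NumberTheory.LFunctions.WindowWeight
  Literature.NumberTheory.LFunctions.AbelianDensity

/-! ### The dichotomy in every degree -/

set_option maxHeartbeats 1600000 in
/-- **Short intervals in EVERY degree, with the exceptional character.**  For `n > 1` there are
`δ, a₀, c > 0` such that for every number field `K` of degree `n`: EITHER for every class `C`, every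
`x ≥ Q^{a₀}` and `x^{1−δ} ≤ h ≤ x`, `h/(8h_K) ≤ ψ_C(x+h) − ψ_C(x) ≤ 4h/h_K`; OR there is a real class group
character `χ₁` with a real zero `β₁ ∈ (1 − c/(log|d_K| + log 4), 1)` of `L(s, χ₁)` (`= ζ_K` if `χ₁ = 1`)
such that for every class `C`, every `x ≥ Q^{a₀}` and `x^{1−δ} ≤ h ≤ x`:
`ψ_C(x+h) − ψ_C(x) ≤ 8h/h_K`, and `h/(8h_K) ≤ ψ_C(x+h) − ψ_C(x)` whenever `χ₁(C) = −1`. -/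
theorem classPsi_shortInterval_dichotomy (n : ℕ) (hn : 1 < n) :
    ∃ δ a₀ c : ℝ, 0 < δ ∧ 0 < a₀ ∧ 0 < c ∧ ∀ (K : Type) [Field K] [NumberField K], Module.finrank ℚ K = n →
      (∀ (C : ClassGroup (𝓞 K)) (x h : ℝ), ThornerZaman.condQn K ^ a₀ ≤ x → x ^ (1 - δ) ≤ h → h ≤ x →
        h / (8 * (NumberField.classNumber K : ℝ)) ≤ classPsi K C (x + h) - classPsi K C x ∧
          classPsi K C (x + h) - classPsi K C x ≤ 4 * h / (NumberField.classNumber K : ℝ)) ∨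
      ∃ (χ₁ : ClassGroup (𝓞 K) →* ℂˣ) (β₁ : ℝ), χ₁ * χ₁ = 1 ∧ classGroupLFunction K χ₁ β₁ = 0 ∧
        1 - c / (Real.log ((NumberField.discr K).natAbs : ℝ) + Real.log 4) < β₁ ∧ β₁ < 1 ∧
        ∀ (C : ClassGroup (𝓞 K)) (x h : ℝ), ThornerZaman.condQn K ^ a₀ ≤ x → x ^ (1 - δ) ≤ h → h ≤ x →
          classPsi K C (x + h) - classPsi K C x ≤ 8 * h / (NumberField.classNumber K : ℝ) ∧
          ((χ₁ C : ℂ) = -1 →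
            h / (8 * (NumberField.classNumber K : ℝ)) ≤ classPsi K C (x + h) - classPsi K C x) := by
  classical
  obtain ⟨A, -, hA⟩ := Residue.residueLowerBound_all n
  obtain ⟨b, D, hb, hD, hdensAll⟩ := fam_density_local n hn A
  obtain ⟨c, hc, hpackAll⟩ := exists_exceptionalZero_const n
  obtain ⟨M, hM1, hM⟩ := TZWeight.exists_smoothTransition_deriv_bound
  obtain ⟨A_L, hAL, hAbd⟩ := exists_norm_logDeriv_classGroupLFunction_left_le
  obtain ⟨hc₁16, hc₂0⟩ := tailConst_nonneg
  have hlC := leftLineConst_nonneg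
  have ha4 : (4 : ℝ) ≤ max A 4 := le_max_right _ _
  have ha1 : (1 : ℝ) ≤ max A 4 := by linarith
  set Λ : ℝ := Real.log (128 * Real.exp 1 * D + 3) with hΛ
  have hΛarg : 1 < 128 * Real.exp 1 * D + 3 := by
    have : 0 < 128 * Real.exp 1 * D := by positivity
    linarith
  have hΛ0 : 0 < Λ := Real.log_pos hΛarg
  set θ : ℝ := min (1 / (8 * b)) (min (1 / 8) (c / (6 * Λ))) with hθ
  have hθ0 : 0 < θ := by positivity
  have hθb : θ * b ≤ 1 / 8 := by
    have h1 : θ ≤ 1 / (8 * b) := min_le_left _ _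
    calc θ * b ≤ 1 / (8 * b) * b := mul_le_mul_of_nonneg_right h1 hb.le
      _ = 1 / 8 := by field_simp
  have hθ1 : θ ≤ 1 / 8 := (min_le_right _ _).trans (min_le_left _ _)
  have hθΛ : θ ≤ c / (6 * Λ) := (min_le_right _ _).trans (min_le_right _ _)
  have hθflat : 2 * Real.exp 1 * D * Real.exp (-(c / (6 * θ))) ≤ 1 / 64 := by
    have h1 : Λ ≤ c / (6 * θ) := by
      rw [le_div_iff₀ (by positivity)]
      have := (le_div_iff₀ (by positivity : (0 : ℝ) < 6 * Λ)).1 hθΛ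
      linarith
    have h2 : Real.exp (-(c / (6 * θ))) ≤ Real.exp (-Λ) := Real.exp_le_exp.2 (by linarith)
    have h3 : Real.exp (-Λ) = (128 * Real.exp 1 * D + 3)⁻¹ := by
      rw [hΛ, Real.exp_neg, Real.exp_log (by linarith)]
    have h4 : 2 * Real.exp 1 * D * (128 * Real.exp 1 * D + 3)⁻¹ ≤ 1 / 64 := by
      rw [← div_eq_mul_inv, div_le_div_iff₀ (by linarith) (by norm_num)]
      linarith
    calc 2 * Real.exp 1 * D * Real.exp (-(c / (6 * θ))) ≤ 2 * Real.exp 1 * D * Real.exp (-Λ) :=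
          mul_le_mul_of_nonneg_left h2 (by positivity)
      _ ≤ 1 / 64 := by rw [h3]; exact h4
  set CJ : ℝ := 338 * (512 * ((n : ℝ) + 1)) + 96 * M * (512 * ((n : ℝ) + 1)) * (4 * tailConst₁ + tailConst₂) +
    108 + 640 * leftLineConst * A_L * M with hCJ
  have hM0 : 0 ≤ M := by linarith
  have hc₁0 : 0 ≤ tailConst₁ := by linarith
  have hCJ0 : 0 ≤ CJ := by rw [hCJ]; positivity
  obtain ⟨a₁, ha₁1, habsAll⟩ := absorb_junk (32 * CJ) θ (by positivity) hθ0 (by linarith)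
  set a₀ : ℝ := max a₁ (max A 4 / θ) with ha₀
  have ha₀1 : 1 ≤ a₀ := ha₁1.trans (le_max_left _ _)
  refine ⟨θ / 8, a₀, c, by positivity, by linarith, hc, fun K _ _ hKn ↦ ?_⟩
  have hK : 1 < Module.finrank ℚ K := by rw [hKn]; exact hn
  set Q : ℝ := ThornerZaman.condQn K with hQ
  have hQ12 : (12 : ℝ) ≤ Q := ThornerZaman.twelve_le_condQn (K := K) hK
  have hQ1 : (1 : ℝ) < Q := by linarith
  obtain ⟨-, -, hlog12⟩ := log_small_consts
  have hlogQ : 2 ≤ Real.log Q := hlog12.trans (Real.log_le_log (by norm_num) hQ12)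
  have hdens := hdensAll K hKn (hA K hKn)
  obtain ⟨hLPreal, hLPuniq, hLPsimple⟩ := hpackAll K hKn
  have hh1 : (1 : ℝ) ≤ (NumberField.classNumber K : ℝ) := by exact_mod_cast one_le_classNumber (K := K)
  have hhKpos : (0 : ℝ) < (NumberField.classNumber K : ℝ) := by linarith
  -- the two windows: from a norm estimate with exceptional term `s F(−σ)` to bounds for `ψ_C(x+h) − ψ_C(x)`
  have hwin : ∀ (x h : ℝ), Q ^ a₀ ≤ x → x ^ (1 - θ / 8) ≤ h → h ≤ x → ∀ (C : ClassGroup (𝓞 K))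
      (Exc : AddChar (Additive (ClassGroup (𝓞 K))) ℂ → Finset ℂ),
      (∀ ψ, ∀ ρ ∈ Exc ψ, famF K ψ ρ = 0 ∧ 0 < ρ.re ∧ ρ.re < 1) →
      (∀ ψ ρ, famF K ψ ρ = 0 → 0 < ρ.re → ρ.re < 1 → excRegion c K ρ → ρ ∈ Exc ψ) →
      ∀ (s σ : ℝ), (s = 0 ∨ s = 1 ∨ s = -1) → σ ≤ 1 →
      (∀ lo hi : ℝ, ∑ ψ : AddChar (Additive (ClassGroup (𝓞 K))) ℂ, ψ (Additive.ofMul C⁻¹) *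
          ∑ ρ ∈ Exc ψ, (famMult K ψ ρ : ℂ) * fordLaplace (windowTest lo hi (Real.log (1 + h / x) / 4)) (-ρ) =
        (s : ℂ) * fordLaplace (windowTest lo hi (Real.log (1 + h / x) / 4)) (-(σ : ℂ))) →
      classPsi K C (x + h) - classPsi K C x ≤ 8 * h / (NumberField.classNumber K : ℝ) ∧
      (s ≤ 0 → h / (8 * (NumberField.classNumber K : ℝ)) ≤ classPsi K C (x + h) - classPsi K C x) ∧
      (s = 0 → classPsi K C (x + h) - classPsi K C x ≤ 4 * h / (NumberField.classNumber K : ℝ)) := by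
    intro x h hx hhx hhx' C Exc hExc hExc' s σ hs hσ hE
    have hQx : Q ≤ x := by
      have := (Real.rpow_le_rpow_of_exponent_le hQ1.le ha₀1).trans hx
      rwa [Real.rpow_one] at this
    have hx1 : 1 < x := by linarith
    have hx0 : 0 < x := by linarith
    set L : ℝ := Real.log x with hL
    have hL0 : 0 < L := Real.log_pos hx1
    have hxaθ : Q ^ (max A 4 / θ) ≤ x := (Real.rpow_le_rpow_of_exponent_le hQ1.le (le_max_right _ _)).trans hx
    have haθ : max A 4 * Real.log Q ≤ θ * L := by
      have h1 := Real.log_le_log (by positivity) hxaθ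
      rw [Real.log_rpow (by linarith), ← hL] at h1
      have h2 : θ * (max A 4 / θ * Real.log Q) = max A 4 * Real.log Q := by field_simp
      have h3 := mul_le_mul_of_nonneg_left h1 hθ0.le
      linarith
    have h2θ : 2 ≤ θ * L := by
      have := mul_le_mul ha4 hlogQ (by norm_num) (le_trans (by norm_num) ha4)
      linarith
    have hL16 : 16 ≤ L := by
      have := mul_le_mul_of_nonneg_right hθ1 hL0.le; linarith
    have hh0 : 0 < h := lt_of_lt_of_le (Real.rpow_pos_of_pos hx0 _) hhx
    set t : ℝ := h / x with ht
    have ht0 : 0 < t := by positivity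
    have ht1 : t ≤ 1 := by rw [ht, div_le_one hx0]; exact hhx'
    have hxt : x * t = h := by rw [ht]; field_simp
    have hxh : x + h = x * (1 + t) := by rw [mul_add, mul_one, hxt]
    set η : ℝ := Real.log (1 + t) with hη
    have hη0 : 0 < η := Real.log_pos (by linarith)
    have hη1 : η ≤ Real.log 2 := Real.log_le_log (by linarith) (by linarith)
    have hηt : t / 2 ≤ η := by
      have h1 := Real.one_sub_inv_le_log_of_pos (show (0 : ℝ) < 1 + t by linarith)
      have h2 : t / 2 ≤ 1 - (1 + t)⁻¹ := by
        rw [show 1 - (1 + t)⁻¹ = t / (1 + t) by field_simp; ring]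
        exact div_le_div_of_nonneg_left ht0.le (by linarith) (by linarith)
      linarith
    have hηt' : η ≤ t := by
      have := Real.log_le_sub_one_of_pos (show (0 : ℝ) < 1 + t by linarith); rw [hη]; linarith
    have hlogxh : Real.log (x + h) = L + η := by
      rw [hxh, Real.log_mul hx0.ne' (by linarith), hL, hη]
    have hε0 : 0 < η / 4 := by positivity
    have hlog2 : Real.log 2 < 0.6931471808 := Real.log_two_lt_d9
    have hη07 : η < 0.7 := by linarith
    set hK' : ℝ := (NumberField.classNumber K : ℝ) with hhK'
    have hxexp : Real.exp L = x := by rw [hL, Real.exp_log hx0]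
    have hxη : x * η ≤ h := by
      have := mul_le_mul_of_nonneg_left hηt' hx0.le; rw [hxt] at this; exact this
    have hxη' : h ≤ 2 * (x * η) := by
      have := mul_le_mul_of_nonneg_left hηt hx0.le; rw [← hxt]; linarith
    have hs1 : |s| ≤ 1 := by rcases hs with h | h | h <;> rw [h] <;> norm_num
    have hxa₁ : Q ^ a₁ ≤ x := (Real.rpow_le_rpow_of_exponent_le hQ1.le (le_max_left _ _)).trans hx
    have hηx : Real.exp (-(θ / 8) * Real.log x) ≤ 2 * η := by
      have h1 : Real.exp (-(θ / 8) * Real.log x) = x ^ (1 - θ / 8) / x := by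
        rw [Real.rpow_def_of_pos hx0, eq_div_iff hx0.ne', ← Real.exp_log hx0, ← Real.exp_add, Real.exp_log hx0]
        congr 1; ring
      rw [h1]
      have h2 : x ^ (1 - θ / 8) / x ≤ h / x := div_le_div_of_nonneg_right hhx hx0.le
      rw [← ht] at h2; linarith
    have habs : (338 * (512 * ((n : ℝ) + 1)) + 96 * M * (512 * ((n : ℝ) + 1)) * (4 * tailConst₁ + tailConst₂) + 108 +
        640 * leftLineConst * A_L * M) * ThornerZaman.condQn K ^ (7 : ℕ) * (Real.log x + 1) *
        Real.exp (-(θ / 4) * Real.log x) ≤ 1 / 32 := by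
      have h1 := habsAll Q x hQ12 hxa₁
      rw [Real.rpow_def_of_pos hx0, show Real.log x * (-(θ / 4)) = -(θ / 4) * Real.log x by ring] at h1
      rw [← hCJ, ← hQ]
      linarith
    have hreal : ∀ {lo hi : ℝ}, L ≤ lo → lo < hi → hi ≤ L + η →
        |hK' * smoothedPsiClass K C (windowTest lo hi (η / 4)) -
          (fordLaplace (windowTest lo hi (η / 4)) (-1)).re +
          s * (fordLaplace (windowTest lo hi (η / 4)) (-(σ : ℂ))).re| ≤ x * η / 8 := by
      intro lo hi hlo hlohi hhi
      have hc' := window_error_le_exc hn hKn hb hD ha1 hdens hc hLPreal hM1 hM hAL hAbd hθ0 hθb hθ1 hθflat hQx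
        haθ h2θ hη0 hη1 hηx habs hlo hlohi hhi C Exc hExc hExc'
      rw [hE lo hi] at hc'
      have hre : ((NumberField.classNumber K : ℂ) * (smoothedPsiClass K C (windowTest lo hi (η / 4)) : ℂ) -
          fordLaplace (windowTest lo hi (η / 4)) (-1) +
          (s : ℂ) * fordLaplace (windowTest lo hi (η / 4)) (-(σ : ℂ))).re =
          hK' * smoothedPsiClass K C (windowTest lo hi (η / 4)) -
            (fordLaplace (windowTest lo hi (η / 4)) (-1)).re +
            s * (fordLaplace (windowTest lo hi (η / 4)) (-(σ : ℂ))).re := by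
        rw [Complex.add_re, Complex.sub_re, ← Complex.ofReal_natCast, ← Complex.ofReal_mul, Complex.ofReal_re,
          Complex.re_ofReal_mul]
      rw [← hre]
      exact (Complex.abs_re_le_norm _).trans hc'
    have hlohiU : L < L + η := by linarith
    have heU := hreal le_rfl hlohiU le_rfl
    have hleU : classPsi K C (x + h) - classPsi K C x ≤ smoothedPsiClass K C (windowTest L (L + η) (η / 4)) := by
      refine classPsi_sub_le_smoothedPsiClass C (x₀ := L + η + η / 4) hx1.le hh0.le
        (fun u ↦ windowTest_nonneg _ _ _ u) (fun u hu1 hu2 ↦ ?_) (fun u hu ↦ windowTest_eq_zero_of_ge hε0 hu)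
      have hu1' : L < u := hu1
      have hu2' : u ≤ Real.log (x + h) := hu2
      rw [hlogxh] at hu2'
      exact windowTest_eq_one hε0 hu1'.le hu2'
    have hmainU := (fordLaplace_windowTest_neg_one_mem (a := L) (b := L + η) hε0 (by linarith) hlohiU.le).2
    obtain ⟨-, hF0U, hF1U⟩ := fordLaplace_windowTest_real_mem_Icc (lo := L) (hi := L + η) hε0 (by linarith)
      hlohiU.le hσ
    have hmtU : Real.exp (L + η + η / 4) - Real.exp (L - η / 4) ≤ 15 / 4 * (x * η) := by
      have h1 : Real.exp (L + η + η / 4) = x * Real.exp (5 * η / 4) := by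
        rw [show L + η + η / 4 = L + 5 * η / 4 by ring, Real.exp_add, hxexp]
      have h2 : Real.exp (L - η / 4) = x * Real.exp (-(η / 4)) := by
        rw [show L - η / 4 = L + -(η / 4) by ring, Real.exp_add, hxexp]
      rw [h1, h2, ← mul_sub]
      have := mul_le_mul_of_nonneg_left (exp_sub_exp_le_eta hη0.le hη07.le) hx0.le
      linarith
    have hsFU : |s * (fordLaplace (windowTest L (L + η) (η / 4)) (-(σ : ℂ))).re| ≤
        (fordLaplace (windowTest L (L + η) (η / 4)) (-1)).re := by
      rw [abs_mul, abs_of_nonneg hF0U]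
      calc |s| * (fordLaplace (windowTest L (L + η) (η / 4)) (-(σ : ℂ))).re
          ≤ 1 * (fordLaplace (windowTest L (L + η) (η / 4)) (-(σ : ℂ))).re := mul_le_mul_of_nonneg_right hs1 hF0U
        _ ≤ (fordLaplace (windowTest L (L + η) (η / 4)) (-1)).re := by rw [one_mul]; exact hF1U
    have hloL : L ≤ L + η / 4 := by linarith
    have hlohiL : L + η / 4 < L + 3 * η / 4 := by linarith
    have hhiL : L + 3 * η / 4 ≤ L + η := by linarith
    have heL := hreal hloL hlohiL hhiL
    have hleL : smoothedPsiClass K C (windowTest (L + η / 4) (L + 3 * η / 4) (η / 4)) ≤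
        classPsi K C (x + h) - classPsi K C x := by
      refine smoothedPsiClass_le_classPsi_sub C hx1.le hh0.le (fun u ↦ windowTest_mem_Icc _ _ _ u)
        (fun u hu ↦ windowTest_eq_zero_of_le hε0 ?_) (fun u hu ↦ ?_)
      · have hu' : u ≤ L := hu
        linarith
      · refine windowTest_eq_zero_of_ge hε0 ?_
        have hu' : Real.log (x + h) ≤ u := hu
        rw [hlogxh] at hu'; linarith
    have hmainL := (fordLaplace_windowTest_neg_one_mem (a := L + η / 4) (b := L + 3 * η / 4) hε0
      (by linarith) hlohiL.le).1
    obtain ⟨-, hF0L, -⟩ := fordLaplace_windowTest_real_mem_Icc (lo := L + η / 4) (hi := L + 3 * η / 4) hε0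
      (by linarith) hlohiL.le hσ
    have hmtL : x * η / 2 ≤ Real.exp (L + 3 * η / 4) - Real.exp (L + η / 4) := by
      rw [Real.exp_add, Real.exp_add, hxexp, ← mul_sub]
      have := mul_le_mul_of_nonneg_left (half_eta_le_exp_sub hη0.le) hx0.le
      linarith
    refine ⟨?_, fun hs0 ↦ ?_, fun hs0 ↦ ?_⟩
    · -- UPPER bound `≤ 8h/h_K`
      have hup : hK' * smoothedPsiClass K C (windowTest L (L + η) (η / 4)) ≤ 2 * (15 / 4 * (x * η)) + x * η / 8 := by
        have h1 := (abs_le.1 heU).2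
        have h2 := (abs_le.1 hsFU).1
        linarith
      calc classPsi K C (x + h) - classPsi K C x ≤ smoothedPsiClass K C (windowTest L (L + η) (η / 4)) := hleU
        _ ≤ (2 * (15 / 4 * (x * η)) + x * η / 8) / hK' := by rw [le_div_iff₀ hhKpos]; linarith
        _ ≤ 8 * h / hK' := by
            refine div_le_div_of_nonneg_right ?_ hhKpos.le
            linarith
    · -- LOWER bound when `s ≤ 0`
      have hsF : s * (fordLaplace (windowTest (L + η / 4) (L + 3 * η / 4) (η / 4)) (-(σ : ℂ))).re ≤ 0 :=
        mul_nonpos_of_nonpos_of_nonneg hs0 hF0L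
      have hlow : x * η / 2 - x * η / 8 ≤
          hK' * smoothedPsiClass K C (windowTest (L + η / 4) (L + 3 * η / 4) (η / 4)) := by
        have := (abs_le.1 heL).1
        linarith
      have h3 : 3 * (x * η) / 8 / hK' ≤ smoothedPsiClass K C (windowTest (L + η / 4) (L + 3 * η / 4) (η / 4)) := by
        rw [div_le_iff₀ hhKpos]; linarith
      calc h / (8 * hK') ≤ 3 * (x * η) / 8 / hK' := by
            rw [div_div, div_le_div_iff₀ (by positivity) (by positivity)]
            exact mul_le_mul_of_nonneg_right (by linarith) (by positivity)
        _ ≤ _ := h3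
        _ ≤ classPsi K C (x + h) - classPsi K C x := hleL
    · -- the sharper UPPER bound `≤ 4h/h_K` when `s = 0`
      have hup : hK' * smoothedPsiClass K C (windowTest L (L + η) (η / 4)) ≤ 15 / 4 * (x * η) + x * η / 8 := by
        have := (abs_le.1 heU).2
        rw [hs0, zero_mul, add_zero] at this
        linarith
      calc classPsi K C (x + h) - classPsi K C x ≤ smoothedPsiClass K C (windowTest L (L + η) (η / 4)) := hleU
        _ ≤ (15 / 4 * (x * η) + x * η / 8) / hK' := by rw [le_div_iff₀ hhKpos]; linarith
        _ ≤ 4 * h / hK' := by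
            refine div_le_div_of_nonneg_right ?_ hhKpos.le
            linarith
  -- the dichotomy on the exceptional zero of the family
  by_cases hex : ∃ (ψ : AddChar (Additive (ClassGroup (𝓞 K))) ℂ) (ρ : ℂ),
      famF K ψ ρ = 0 ∧ 0 < ρ.re ∧ ρ.re < 1 ∧ excRegion c K ρ
  · -- an exceptional zero `(ψ₁, ρ₁)`: real, unique, simple
    right
    obtain ⟨ψ₁, ρ₁, h0₁, hre₁, hre₁', hexc₁⟩ := hex
    have hexcZ : ∀ ψ ρ, famF K ψ ρ = 0 → excRegion c K ρ →
        (((toMulHom ψ).toHomUnits = 1 → dedekindZeta₁ K ρ = 0) ∧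
          ((toMulHom ψ).toHomUnits ≠ 1 → classGroupLFunction₀ K (toMulHom ψ).toHomUnits ρ = 0)) ∧
          1 - c / (Real.log ((NumberField.discr K).natAbs : ℝ) + Real.log (|ρ.im| + 4)) < ρ.re := by
      intro ψ ρ h0 hexc
      refine ⟨famZ_of_famF_eq_zero ψ h0, ?_⟩
      obtain ⟨him, hre⟩ := hexc
      rw [him, abs_zero, zero_add]; exact hre
    have hZ₁ := hexcZ ψ₁ ρ₁ h0₁ hexc₁
    obtain ⟨him₁, hreal₁⟩ := hLPreal _ ρ₁ hZ₁
    have hρne : ρ₁ ≠ 1 := fun h ↦ by rw [h] at hre₁'; simp at hre₁'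
    set β₁ : ℝ := ρ₁.re with hβ₁
    have hρ₁ : ρ₁ = (β₁ : ℂ) := by
      apply Complex.ext <;> simp [hβ₁, him₁]
    have hmult : famMult K ψ₁ ρ₁ = 1 := by
      obtain ⟨hs1, hs2⟩ := hLPsimple _ ρ₁ hZ₁
      by_cases hψ : ψ₁ = 0
      · subst hψ
        have h := hs1 toHomUnits_toMulHom_zero
        have hne : analyticOrderAt (dedekindZeta₁ K) ρ₁ ≠ ⊤ := by rw [h]; exact ENat.one_ne_top
        have : (analyticOrderNatAt (dedekindZeta₁ K) ρ₁ : ℕ∞) = 1 := by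
          rw [Nat.cast_analyticOrderNatAt hne, h]
        rw [famMult, famF_zero]; exact_mod_cast this
      · have h := hs2 (toHomUnits_ne_one hψ)
        have hne : analyticOrderAt (classGroupLFunction₀ K (toMulHom ψ₁).toHomUnits) ρ₁ ≠ ⊤ := by
          rw [h]; exact ENat.one_ne_top
        have : (analyticOrderNatAt (classGroupLFunction₀ K (toMulHom ψ₁).toHomUnits) ρ₁ : ℕ∞) = 1 := by
          rw [Nat.cast_analyticOrderNatAt hne, h]
        rw [famMult, famF_of_ne hψ]; exact_mod_cast this
    set χ₁ : ClassGroup (𝓞 K) →* ℂˣ := (toMulHom ψ₁).toHomUnits with hχ₁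
    have hLz : classGroupLFunction K χ₁ β₁ = 0 := by
      have := classGroupLFunction_eq_zero_of_famF ψ₁ h0₁ hρne
      rwa [hρ₁] at this
    refine ⟨χ₁, β₁, hreal₁, hLz, hexc₁.2, hre₁', fun C x h hx hhx hhx' ↦ ?_⟩
    set Exc : AddChar (Additive (ClassGroup (𝓞 K))) ℂ → Finset ℂ :=
      fun ψ ↦ if ψ = ψ₁ then {ρ₁} else ∅ with hExcdef
    have hExc : ∀ ψ, ∀ ρ ∈ Exc ψ, famF K ψ ρ = 0 ∧ 0 < ρ.re ∧ ρ.re < 1 := by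
      intro ψ ρ hρ
      rw [hExcdef] at hρ; dsimp only at hρ
      split_ifs at hρ with hψ
      · rw [Finset.mem_singleton] at hρ; subst hρ; subst hψ; exact ⟨h0₁, hre₁, hre₁'⟩
      · simp at hρ
    have hExc' : ∀ ψ ρ, famF K ψ ρ = 0 → 0 < ρ.re → ρ.re < 1 → excRegion c K ρ → ρ ∈ Exc ψ := by
      intro ψ ρ h0 _ _ hexc
      have hZ := hexcZ ψ ρ h0 hexc
      obtain ⟨hχ, hρρ⟩ := hLPuniq _ _ ρ ρ₁ hZ hZ₁
      have hψ : ψ = ψ₁ := toHomUnits_toMulHom_injective hχ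
      rw [hExcdef]; dsimp only; rw [if_pos hψ, Finset.mem_singleton]; exact hρρ
    have hsval := classGroupChar_apply_eq_one_or_eq_neg_one hreal₁ C⁻¹
    set s : ℝ := if (χ₁ C⁻¹ : ℂ) = 1 then 1 else -1 with hsdef
    have hsC : (χ₁ C⁻¹ : ℂ) = (s : ℂ) := by
      rcases hsval with h | h
      · rw [hsdef, if_pos h, h]; norm_num
      · rw [hsdef, if_neg (by rw [h]; norm_num), h]; norm_num
    have hs : s = 0 ∨ s = 1 ∨ s = -1 := by
      rw [hsdef]; split_ifs
      · exact Or.inr (Or.inl rfl)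
      · exact Or.inr (Or.inr rfl)
    have hE : ∀ lo hi : ℝ, ∑ ψ : AddChar (Additive (ClassGroup (𝓞 K))) ℂ, ψ (Additive.ofMul C⁻¹) *
        ∑ ρ ∈ Exc ψ, (famMult K ψ ρ : ℂ) * fordLaplace (windowTest lo hi (Real.log (1 + h / x) / 4)) (-ρ) =
        (s : ℂ) * fordLaplace (windowTest lo hi (Real.log (1 + h / x) / 4)) (-(β₁ : ℂ)) := by
      intro lo hi
      rw [Finset.sum_eq_single ψ₁]
      · rw [hExcdef]; dsimp only
        rw [if_pos rfl, Finset.sum_singleton, hmult, ← hρ₁, ← toHomUnits_toMulHom_apply, ← hχ₁, hsC]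
        push_cast; ring
      · intro ψ _ hψ
        rw [hExcdef]; dsimp only; rw [if_neg hψ, Finset.sum_empty, mul_zero]
      · intro h; exact absurd (Finset.mem_univ _) h
    obtain ⟨hup, hlow, -⟩ := hwin x h hx hhx hhx' C Exc hExc hExc' s β₁ hs hre₁'.le hE
    refine ⟨hup, fun hC ↦ hlow ?_⟩
    have hCinv := classGroupChar_inv_eq_neg_one hreal₁ hC
    rw [hsdef, if_neg (by rw [hCinv]; norm_num)]; norm_num
  · -- no exceptional zero
    left
    intro C x h hx hhx hhx'
    have hE : ∀ lo hi : ℝ, ∑ ψ : AddChar (Additive (ClassGroup (𝓞 K))) ℂ, ψ (Additive.ofMul C⁻¹) *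
        ∑ ρ ∈ (fun _ ↦ (∅ : Finset ℂ)) ψ, (famMult K ψ ρ : ℂ) *
          fordLaplace (windowTest lo hi (Real.log (1 + h / x) / 4)) (-ρ) =
        ((0 : ℝ) : ℂ) * fordLaplace (windowTest lo hi (Real.log (1 + h / x) / 4)) (-((1 : ℝ) : ℂ)) := by
      intro lo hi; simp
    obtain ⟨-, hlow, hup⟩ := hwin x h hx hhx hhx' C (fun _ ↦ ∅) (fun ψ ρ hρ ↦ by simp at hρ)
      (fun ψ ρ h0 h1 h2 hexc ↦ absurd ⟨ψ, ρ, h0, h1, h2, hexc⟩ hex) 0 1 (Or.inl rfl) le_rfl hE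
    exact ⟨hlow le_rfl, hup rfl⟩

/-- **Brun–Titchmarsh in short intervals for ideal classes, every number field, unconditionally.**  For
`n > 1` there are `δ, a₀ > 0` such that for every number field `K` of degree `n`, every class `C`, every
`x ≥ Q^{a₀}` and `x^{1−δ} ≤ h ≤ x`: `ψ_C(x+h) − ψ_C(x) ≤ 8h/h_K`. -/
theorem classPsi_shortInterval_upper (n : ℕ) (hn : 1 < n) :
    ∃ δ a₀ : ℝ, 0 < δ ∧ 0 < a₀ ∧ ∀ (K : Type) [Field K] [NumberField K], Module.finrank ℚ K = n →
      ∀ (C : ClassGroup (𝓞 K)) (x h : ℝ), ThornerZaman.condQn K ^ a₀ ≤ x → x ^ (1 - δ) ≤ h → h ≤ x →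
        classPsi K C (x + h) - classPsi K C x ≤ 8 * h / (NumberField.classNumber K : ℝ) := by
  obtain ⟨δ, a₀, c, hδ, ha₀, -, hK⟩ := classPsi_shortInterval_dichotomy n hn
  refine ⟨δ, a₀, hδ, ha₀, fun K _ _ hKn C x h hx hhx hhx' ↦ ?_⟩
  rcases hK K hKn with hall | ⟨χ₁, β₁, -, -, -, -, hexc⟩
  · have h2 := (hall C x h hx hhx hhx').2
    have hh1 : (1 : ℝ) ≤ (NumberField.classNumber K : ℝ) := by exact_mod_cast one_le_classNumber (K := K)
    have hx0 : 0 < x := by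
      have hK1 : 1 < Module.finrank ℚ K := by rw [hKn]; exact hn
      have hQ12 : (12 : ℝ) ≤ ThornerZaman.condQn K := ThornerZaman.twelve_le_condQn (K := K) hK1
      have := Real.rpow_pos_of_pos (by linarith : (0 : ℝ) < ThornerZaman.condQn K) a₀
      linarith
    have hh0 : 0 ≤ h := (Real.rpow_pos_of_pos hx0 _).le.trans hhx
    exact h2.trans (div_le_div_of_nonneg_right (by linarith) (by positivity))
  · exact (hexc C x h hx hhx hhx').1

end Summit.QuantumAdvantage.QuantumAdvantage.Theorems.DegreeOnePrimesEscape

end
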